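import Summits.AnomalousDissipation.AnomalousDissipation.Theorems.MarginalStabilityChainStrainedLayerLawLine
import Mathlib.MeasureTheory.Integral.Prod

/-!
# Capture bookkeeping of the line `contraction-capture` (crux stmt-AnomalousDissipation-3007
`MarginalStabilityChain.StrainedLayerLaw`): the circulation clause of `IsCaptured` is redundant

Def-free landing (worker W5 for the lead `prover-line-stmt-AnomalousDissipation-3007-0`, 2026-08-16; the measure theory is worker
W4's analysis file `work/stubs/stub_coarseCapture.lean`, §2 and §5, verbatim up to explicit binders) of the CAPTURE BOOKKEEPING of
the line: for a class slice `(u t, v t)` at `t > 0` of period `ℓ` whose `∂ₓv(t)` is integrable on the period strip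
`(a − ℓ/2, a + ℓ/2] × ℝ`, finiteness of the `|ω|`-mass of the cell OUTSIDE the box `Q = [a−r, a+r] × [b−r, b+r]` (`r < ℓ/2`) forces
`ω(t) ∈ L¹(strip)`; the Lebesgue cell circulation is then `−ℓ` (`∫ ∂_y u dy = [u]_{−∞}^{+∞} = 1` fibrewise by the class's far field,
`∫∫ ∂ₓv = 0` by `ℓ`-periodicity), hence `boxCirc + ℓ = −∫∫_{strip ∖ Q} ω` and
`|boxCirc (u t) (v t) a b r + ℓ| ≤ cellAbsVortOutside ℓ (u t) (v t) a b r` (`captureBookkeeping`). So the CIRCULATION clause of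
`IsCaptured` is REDUNDANT given the outside-mass clause, and the registered stub `stub_coarseCapture` of the line (eventual-and-forever
coarse capture `IsCaptured ℓ ε (ℓ/4)` of every class solution from one seeded short-cell datum, uniformly in small `ν`) REDUCES,
kernel-checked, to the inlined hypothesis "MassCapture `ε`" of `coarseCapture_of_massCapture` (same quantifier prefix; conclusion: the
two MASS clauses of `IsCaptured` at tolerance `ε/2` plus integrability of `∂ₓv(t)` on the strip) — which is OPEN: it is the dynamical
content of the outer half of the line (formation + persistence of one captured core per cell), not touched here.

Contents (all sorry-free, standard axioms): §1 no junk at `t > 0` (`continuous_dX_of_contDiff`, `continuous_dY_of_contDiff`,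
`continuous_vort_of_contDiff`, `integrableOn_vort_box`, `setIntegral_box_eq_boxCirc`, `InClass.continuous_vort`,
`InClass.setIntegral_box`: slices are `C²`, so `vort` is jointly continuous and `boxCirc` is an honest Lebesgue integral); §2 the two
FTCs (`InClass.integral_dY_u` across the layer, `InClass.setIntegral_dX_v` along one period); §3 `captureBookkeeping` (Tonelli/Fubini on
the strip measure `(volume.restrict (Ioc (a−ℓ/2) (a+ℓ/2))).prod volume`); §4 the registered reduction `coarseCapture_of_massCapture`.

References: the line module `Theorems/MarginalStabilityChainStrainedLayerLawLine.lean` (`InClass`, `vort`, `boxCirc`, `cellPosVort`,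
`cellAbsVortOutside`, `IsCaptured`); `Literature/Analysis/FluidPDE/StretchedLayerNS.lean` (`StretchedLayer.dX/dY`); Majda–Bertozzi 2002
§1.4 (the stretched 2-D class; the bookkeeping itself is folklore calculus).
-/

set_option linter.dupNamespace false

noncomputable section

open scoped BigOperators Topology ENNReal
open Filter Set Function MeasureTheory

namespace Summit.AnomalousDissipation.AnomalousDissipation.Theorems.StrainedLayerLaw.ContractionCapture

open Literature.Analysis.FluidPDE Literature.Analysis.FluidPDE.StretchedLayer
open Summit.AnomalousDissipation.AnomalousDissipation.Theses.MarginalStabilityChain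

/-! ## §1 No junk at `t > 0`: slice derivatives of `C¹` plane fields are jointly continuous -/

/-- `∂ₓ` of a jointly `Cⁿ` (`n ≠ 0`) plane field, as a function on `ℝ²`, is continuous: the slice derivative is the Fréchet
derivative applied to `(1, 0)` (chain rule along `s ↦ (s, y)`), and `fderiv` of a `C¹` map is continuous. [folklore] -/
theorem continuous_dX_of_contDiff {g : ℝ → ℝ → ℝ} {n : WithTop ℕ∞}
    (hg : ContDiff ℝ n (fun q : ℝ × ℝ => g q.1 q.2)) (hn : n ≠ 0) :
    Continuous (fun q : ℝ × ℝ => dX g q.1 q.2) := by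
  have hd : ∀ x y : ℝ, dX g x y = fderiv ℝ (fun q : ℝ × ℝ => g q.1 q.2) (x, y) (1, 0) := by
    intro x y
    have h1 : HasFDerivAt (fun q : ℝ × ℝ => g q.1 q.2) (fderiv ℝ (fun q : ℝ × ℝ => g q.1 q.2) (x, y)) (x, y) :=
      ((hg.differentiable hn) (x, y)).hasFDerivAt
    have h2 : HasDerivAt (fun s : ℝ => ((s, y) : ℝ × ℝ)) ((1 : ℝ), (0 : ℝ)) x :=
      (hasDerivAt_id' x).prodMk (hasDerivAt_const x y)
    simpa only [dX, Function.comp_def] using (h1.comp_hasDerivAt x h2).deriv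
  rw [show (fun q : ℝ × ℝ => dX g q.1 q.2) = fun q => fderiv ℝ (fun q : ℝ × ℝ => g q.1 q.2) q (1, 0) from
    funext fun q => hd q.1 q.2]
  exact (hg.continuous_fderiv hn).clm_apply continuous_const

/-- `∂_y` of a jointly `Cⁿ` (`n ≠ 0`) plane field is continuous on `ℝ²` (as `continuous_dX_of_contDiff`, along `s ↦ (x, s)`).
[folklore] -/
theorem continuous_dY_of_contDiff {f : ℝ → ℝ → ℝ} {n : WithTop ℕ∞}
    (hf : ContDiff ℝ n (fun q : ℝ × ℝ => f q.1 q.2)) (hn : n ≠ 0) :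
    Continuous (fun q : ℝ × ℝ => dY f q.1 q.2) := by
  have hd : ∀ x y : ℝ, dY f x y = fderiv ℝ (fun q : ℝ × ℝ => f q.1 q.2) (x, y) (0, 1) := by
    intro x y
    have h1 : HasFDerivAt (fun q : ℝ × ℝ => f q.1 q.2) (fderiv ℝ (fun q : ℝ × ℝ => f q.1 q.2) (x, y)) (x, y) :=
      ((hf.differentiable hn) (x, y)).hasFDerivAt
    have h2 : HasDerivAt (fun s : ℝ => ((x, s) : ℝ × ℝ)) ((0 : ℝ), (1 : ℝ)) y :=
      (hasDerivAt_const y x).prodMk (hasDerivAt_id' y)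
    simpa only [dY, Function.comp_def] using (h1.comp_hasDerivAt y h2).deriv
  rw [show (fun q : ℝ × ℝ => dY f q.1 q.2) = fun q => fderiv ℝ (fun q : ℝ × ℝ => f q.1 q.2) q (0, 1) from
    funext fun q => hd q.1 q.2]
  exact (hf.continuous_fderiv hn).clm_apply continuous_const

/-- The vorticity `vort f g = ∂ₓg − ∂_yf` of a `Cⁿ` (`n ≠ 0`) slice is jointly continuous on `ℝ²`. [folklore] -/
theorem continuous_vort_of_contDiff {f g : ℝ → ℝ → ℝ} {n : WithTop ℕ∞}
    (hf : ContDiff ℝ n (fun q : ℝ × ℝ => f q.1 q.2)) (hg : ContDiff ℝ n (fun q : ℝ × ℝ => g q.1 q.2)) (hn : n ≠ 0) :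
    Continuous (fun q : ℝ × ℝ => vort f g q.1 q.2) := by
  simp only [vort]
  exact (continuous_dX_of_contDiff hg hn).sub (continuous_dY_of_contDiff hf hn)

/-- Hence `vort` of a `Cⁿ` (`n ≠ 0`) slice is integrable on every closed box (compactness). [folklore] -/
theorem integrableOn_vort_box {f g : ℝ → ℝ → ℝ} {n : WithTop ℕ∞}
    (hf : ContDiff ℝ n (fun q : ℝ × ℝ => f q.1 q.2)) (hg : ContDiff ℝ n (fun q : ℝ × ℝ => g q.1 q.2)) (hn : n ≠ 0)
    (a b ρ : ℝ) :
    IntegrableOn (fun q : ℝ × ℝ => vort f g q.1 q.2) (Icc (a - ρ) (a + ρ) ×ˢ Icc (b - ρ) (b + ρ)) :=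
  (continuous_vort_of_contDiff hf hg hn).continuousOn.integrableOn_compact (isCompact_Icc.prod isCompact_Icc)

/-- **`boxCirc` is an honest integral for `C¹` slices**: the Lebesgue integral of `vort f g` over the closed box equals the
iterated integral `boxCirc f g a b ρ` (Fubini for an integrable function on the product). In particular no junk value enters the
clause `|boxCirc + ℓ| ≤ εℓ` of `IsCaptured` for class slices at `t > 0`. [folklore] -/
theorem setIntegral_box_eq_boxCirc {f g : ℝ → ℝ → ℝ} {n : WithTop ℕ∞}
    (hf : ContDiff ℝ n (fun q : ℝ × ℝ => f q.1 q.2)) (hg : ContDiff ℝ n (fun q : ℝ × ℝ => g q.1 q.2)) (hn : n ≠ 0)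
    (a b ρ : ℝ) :
    ∫ q in Icc (a - ρ) (a + ρ) ×ˢ Icc (b - ρ) (b + ρ), vort f g q.1 q.2 = boxCirc f g a b ρ := by
  have hi : IntegrableOn (fun q : ℝ × ℝ => vort f g q.1 q.2) (Icc (a - ρ) (a + ρ) ×ˢ Icc (b - ρ) (b + ρ))
      ((volume : Measure ℝ).prod (volume : Measure ℝ)) := by
    rw [← Measure.volume_eq_prod]
    exact integrableOn_vort_box hf hg hn a b ρ
  rw [Measure.volume_eq_prod, setIntegral_prod _ hi]
  rfl

/-- For a class solution and `t > 0` the slice vorticity `ω(t) = vort (u t) (v t)` is jointly continuous on `ℝ²` (slices are `C²`,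
`InClass.contDiff_slices`). [folklore] -/
theorem InClass.continuous_vort {ν L : ℝ} {θ₁ θ₂ : ℝ → ℝ → ℝ} {u v p : ℝ → ℝ → ℝ → ℝ}
    (h : InClass ν L θ₁ θ₂ u v p) {t : ℝ} (ht : 0 < t) :
    Continuous (fun q : ℝ × ℝ => vort (u t) (v t) q.1 q.2) :=
  continuous_vort_of_contDiff (h.contDiff_slices ht).1 (h.contDiff_slices ht).2 (by norm_num)

/-- For a class solution and `t > 0`, `boxCirc (u t) (v t) a b ρ` is the Lebesgue integral of `ω(t)` over the closed box.
[folklore] -/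
theorem InClass.setIntegral_box {ν L : ℝ} {θ₁ θ₂ : ℝ → ℝ → ℝ} {u v p : ℝ → ℝ → ℝ → ℝ}
    (h : InClass ν L θ₁ θ₂ u v p) {t : ℝ} (ht : 0 < t) (a b ρ : ℝ) :
    ∫ q in Icc (a - ρ) (a + ρ) ×ˢ Icc (b - ρ) (b + ρ), vort (u t) (v t) q.1 q.2 = boxCirc (u t) (v t) a b ρ :=
  ContractionCapture.setIntegral_box_eq_boxCirc (h.contDiff_slices ht).1 (h.contDiff_slices ht).2 (by norm_num) a b ρ

/-! ## §2 FTC across the layer and along one period -/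


/-- FTC across the layer: for a class solution, `t > 0` and any `x`, if `y ↦ ∂_y u(t,x,y)` is integrable then
`∫ ∂_y u (t,x,y) dy = ½ − (−½) = 1` (the slice is `C²`, the far field is the class's). [folklore] -/
theorem InClass.integral_dY_u {ν L : ℝ} {θ₁ θ₂ : ℝ → ℝ → ℝ} {u v p : ℝ → ℝ → ℝ → ℝ}
    (h : InClass ν L θ₁ θ₂ u v p) {t : ℝ} (ht : 0 < t) (x : ℝ) (hi : Integrable (fun y => dY (u t) x y)) :
    ∫ y, dY (u t) x y = 1 := by
  have hC := (h.contDiff_slices ht).1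
  have hg : ContDiff ℝ 2 (fun y : ℝ => ((x, y) : ℝ × ℝ)) := contDiff_const.prodMk contDiff_id
  have hsl : ContDiff ℝ 2 (fun y => u t x y) := hC.comp hg
  have hderiv : ∀ y, HasDerivAt (fun s => u t x s) (dY (u t) x y) y := fun y =>
    ((hsl.differentiable (by norm_num)) y).hasDerivAt
  obtain ⟨htop, hbot, -, -⟩ := h.2.2.2.2.2.2.2.1 t x ht.le
  rw [integral_of_hasDerivAt_of_tendsto hderiv hi hbot htop]
  norm_num

/-- FTC along the layer: for a class solution of period `L > 0`, `t > 0` and any `y`, the `x`-integral of `∂ₓ v` over one period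
window vanishes (continuous derivative + `L`-periodicity of the slice). [folklore] -/
theorem InClass.setIntegral_dX_v {ν L : ℝ} {θ₁ θ₂ : ℝ → ℝ → ℝ} {u v p : ℝ → ℝ → ℝ → ℝ}
    (h : InClass ν L θ₁ θ₂ u v p) {t : ℝ} (ht : 0 < t) (hL : 0 < L) (a y : ℝ) :
    ∫ x in Ioc (a - L / 2) (a + L / 2), dX (v t) x y = 0 := by
  have hC := (h.contDiff_slices ht).2
  have hg : ContDiff ℝ 2 (fun x : ℝ => ((x, y) : ℝ × ℝ)) := contDiff_id.prodMk contDiff_const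
  have hsl : ContDiff ℝ 2 (fun x => v t x y) := hC.comp hg
  have hderiv : ∀ x, HasDerivAt (fun s => v t s y) (dX (v t) x y) x := fun x =>
    ((hsl.differentiable (by norm_num)) x).hasDerivAt
  have hcont : Continuous (fun x => dX (v t) x y) := hsl.continuous_deriv (by norm_num)
  have hle : a - L / 2 ≤ a + L / 2 := by linarith
  rw [← intervalIntegral.integral_of_le hle,
    intervalIntegral.integral_eq_sub_of_hasDerivAt (fun x _ => hderiv x) (hcont.intervalIntegrable _ _)]
  have hp := (h.periodic_slices t (a - L / 2) y ht).2
  rw [show a - L / 2 + L = a + L / 2 by ring] at hp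
  rw [hp, sub_self]

/-! ## §3 Capture bookkeeping: the circulation clause of `IsCaptured` follows from the mass clause -/

/-- **Capture bookkeeping.** For a class solution of period `ℓ > 0`, a time `t > 0`, a box of half-side `0 < r < ℓ/2` centred at
`(a, b)`, with `∂ₓv(t)` integrable on the period strip `(a − ℓ/2, a + ℓ/2] × ℝ` and finite outside-`|ω|`-mass: the box circulation is
`−ℓ` up to that outside mass, `|boxCirc (u t) (v t) a b r + ℓ| ≤ (cellAbsVortOutside ℓ (u t) (v t) a b r).toReal`. Proof: Tonelli
identifies the outside mass with a lintegral over the strip measure, so `ω(t) ∈ L¹(strip)` (inside the box by continuity); Fubini and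
the fibrewise FTCs give Lebesgue cell circulation `∫∫_strip ω = 0 − ℓ·1 = −ℓ` (no bound on `u` is needed: the far-field FTC is applied
for a.e. `x` separately); splitting the strip into the box (`= boxCirc`, `InClass.setIntegral_box`) and its complement, the complement
part is bounded by the outside `|ω|`-mass (`enorm_integral_le_lintegral_enorm`). [folklore] -/
theorem captureBookkeeping {ν ℓ : ℝ} {θ₁ θ₂ : ℝ → ℝ → ℝ} {u v p : ℝ → ℝ → ℝ → ℝ} {t a b r : ℝ}
    (hIn : InClass ν ℓ θ₁ θ₂ u v p) (hℓ : 0 < ℓ) (ht : 0 < t) (hr : 0 < r) (hrℓ : r < ℓ / 2)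
    (hint : Integrable (fun q : ℝ × ℝ => dX (v t) q.1 q.2) ((volume.restrict (Ioc (a - ℓ / 2) (a + ℓ / 2))).prod volume))
    (hfin : cellAbsVortOutside ℓ (u t) (v t) a b r ≠ ⊤) :
    |boxCirc (u t) (v t) a b r + ℓ| ≤ (cellAbsVortOutside ℓ (u t) (v t) a b r).toReal := by
  set B : Set (ℝ × ℝ) := Icc (a - r) (a + r) ×ˢ Icc (b - r) (b + r) with hB
  set ω : ℝ × ℝ → ℝ := fun q => vort (u t) (v t) q.1 q.2 with hω
  have hωc : Continuous ω := hIn.continuous_vort ht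
  have hωm : Measurable ω := hωc.measurable
  have hBm : MeasurableSet B := measurableSet_Icc.prod measurableSet_Icc
  have hμeq : ((volume.restrict (Ioc (a - ℓ / 2) (a + ℓ / 2))).prod volume : Measure (ℝ × ℝ)) =
      (volume : Measure (ℝ × ℝ)).restrict (Ioc (a - ℓ / 2) (a + ℓ / 2) ×ˢ (univ : Set ℝ)) := by
    rw [Measure.volume_eq_prod, ← Measure.prod_restrict, Measure.restrict_univ]
  have hμle : ((volume.restrict (Ioc (a - ℓ / 2) (a + ℓ / 2))).prod volume : Measure (ℝ × ℝ)) ≤ volume := by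
    rw [hμeq]
    exact Measure.restrict_le_self
  -- (A) the outside `|ω|`-mass is a lintegral over the strip measure (Tonelli)
  have hmeas : Measurable (Bᶜ.indicator fun q : ℝ × ℝ => ENNReal.ofReal |ω q|) :=
    ((continuous_abs.measurable.comp hωm).ennreal_ofReal).indicator hBm.compl
  have hA : ∫⁻ q, Bᶜ.indicator (fun q : ℝ × ℝ => ENNReal.ofReal |ω q|) q
      ∂((volume.restrict (Ioc (a - ℓ / 2) (a + ℓ / 2))).prod volume) = cellAbsVortOutside ℓ (u t) (v t) a b r := by
    rw [lintegral_prod _ hmeas.aemeasurable]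
    rfl
  have hfinite : ∫⁻ q, Bᶜ.indicator (fun q : ℝ × ℝ => ENNReal.ofReal |ω q|) q
      ∂((volume.restrict (Ioc (a - ℓ / 2) (a + ℓ / 2))).prod volume) < ⊤ := by
    rw [hA]
    exact lt_top_iff_ne_top.2 hfin
  -- (B) `ω` is integrable on the strip
  have hIntB : IntegrableOn ω B ((volume.restrict (Ioc (a - ℓ / 2) (a + ℓ / 2))).prod volume) :=
    (integrableOn_vort_box (hIn.contDiff_slices ht).1 (hIn.contDiff_slices ht).2 (by norm_num) a b r).mono_measure
      hμle
  have hIntBc : IntegrableOn ω Bᶜ ((volume.restrict (Ioc (a - ℓ / 2) (a + ℓ / 2))).prod volume) := by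
    refine ⟨hωc.aestronglyMeasurable, ?_⟩
    rw [hasFiniteIntegral_iff_enorm, ← lintegral_indicator hBm.compl]
    simp_rw [Real.enorm_eq_ofReal_abs]
    exact hfinite
  have hInt : Integrable ω ((volume.restrict (Ioc (a - ℓ / 2) (a + ℓ / 2))).prod volume) := by
    have := hIntB.union hIntBc
    rwa [union_compl_self, integrableOn_univ] at this
  -- (C) the Lebesgue cell circulation is `−ℓ`
  have hperiod : ∫ x in Ioc (a - ℓ / 2) (a + ℓ / 2), ∫ y, dX (v t) x y = 0 := by
    have e : ∫ q, dX (v t) q.1 q.2 ∂((volume.restrict (Ioc (a - ℓ / 2) (a + ℓ / 2))).prod volume) =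
        ∫ x in Ioc (a - ℓ / 2) (a + ℓ / 2), ∫ y, dX (v t) x y := integral_prod _ hint
    have e' : ∫ q, dX (v t) q.1 q.2 ∂((volume.restrict (Ioc (a - ℓ / 2) (a + ℓ / 2))).prod volume) =
        ∫ y, ∫ x in Ioc (a - ℓ / 2) (a + ℓ / 2), dX (v t) x y := integral_prod_symm _ hint
    rw [← e, e']
    simp only [hIn.setIntegral_dX_v ht hℓ, integral_zero]
  have hae : (fun x => ∫ y, ω (x, y)) =ᵐ[volume.restrict (Ioc (a - ℓ / 2) (a + ℓ / 2))]
      fun x => (∫ y, dX (v t) x y) - 1 := by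
    have h1 : ∀ᵐ x ∂(volume.restrict (Ioc (a - ℓ / 2) (a + ℓ / 2))), Integrable (fun y => ω (x, y)) :=
      hInt.prod_right_ae
    have h2 : ∀ᵐ x ∂(volume.restrict (Ioc (a - ℓ / 2) (a + ℓ / 2))), Integrable (fun y => dX (v t) x y) :=
      hint.prod_right_ae
    filter_upwards [h1, h2] with x hx1 hx2
    have hx3 : Integrable (fun y => dY (u t) x y) := by
      refine (hx2.sub hx1).congr (ae_of_all _ fun y => ?_)
      simp only [hω, vort, Pi.sub_apply, sub_sub_cancel]
    have e1 : ∫ y, ω (x, y) = ∫ y, (dX (v t) x y - dY (u t) x y) := rfl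
    rw [e1, integral_sub hx2 hx3, hIn.integral_dY_u ht x hx3]
  have hcell : ∫ q, ω q ∂((volume.restrict (Ioc (a - ℓ / 2) (a + ℓ / 2))).prod volume) = -ℓ := by
    have hf : Integrable (fun x => ∫ y, dX (v t) x y) (volume.restrict (Ioc (a - ℓ / 2) (a + ℓ / 2))) :=
      hint.integral_prod_left
    rw [integral_prod _ hInt, integral_congr_ae hae, integral_sub hf (integrable_const _), hperiod,
      setIntegral_const, Real.volume_real_Ioc_of_le (by linarith), smul_eq_mul]
    ring
  -- (D) split the strip into the box and its complement; the box part is `boxCirc`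
  have hsub : B ⊆ Ioc (a - ℓ / 2) (a + ℓ / 2) ×ˢ (univ : Set ℝ) := by
    intro q hq
    rw [hB] at hq
    exact ⟨⟨by linarith [hq.1.1], by linarith [hq.1.2]⟩, mem_univ _⟩
  have hbox : ∫ q in B, ω q ∂((volume.restrict (Ioc (a - ℓ / 2) (a + ℓ / 2))).prod volume) =
      boxCirc (u t) (v t) a b r := by
    have hres : ((volume.restrict (Ioc (a - ℓ / 2) (a + ℓ / 2))).prod volume).restrict B =
        (volume : Measure (ℝ × ℝ)).restrict B := by
      rw [hμeq, Measure.restrict_restrict hBm, inter_eq_left.mpr hsub]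
    change ∫ q, ω q ∂(((volume.restrict (Ioc (a - ℓ / 2) (a + ℓ / 2))).prod volume).restrict B) = _
    rw [hres]
    exact hIn.setIntegral_box ht a b r
  have hsplit := integral_add_compl hBm hInt
  rw [hbox, hcell] at hsplit
  -- (E) the complement part is bounded by the outside `|ω|`-mass
  have hE : ‖∫ q in Bᶜ, ω q ∂((volume.restrict (Ioc (a - ℓ / 2) (a + ℓ / 2))).prod volume)‖ₑ ≤
      cellAbsVortOutside ℓ (u t) (v t) a b r := by
    refine (enorm_integral_le_lintegral_enorm _).trans (le_of_eq ?_)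
    rw [← lintegral_indicator hBm.compl, ← hA]
    simp_rw [Real.enorm_eq_ofReal_abs]
  have hE' : |∫ q in Bᶜ, ω q ∂((volume.restrict (Ioc (a - ℓ / 2) (a + ℓ / 2))).prod volume)| ≤
      (cellAbsVortOutside ℓ (u t) (v t) a b r).toReal := by
    rw [← Real.norm_eq_abs, ← toReal_enorm]
    exact ENNReal.toReal_mono hfin hE
  have hkey : boxCirc (u t) (v t) a b r + ℓ =
      -∫ q in Bᶜ, ω q ∂((volume.restrict (Ioc (a - ℓ / 2) (a + ℓ / 2))).prod volume) := by
    linarith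
  rw [hkey, abs_neg]
  exact hE'

/-! ## §4 The registered reduction: `stub_coarseCapture ⇐ MassCapture ε` -/

/-- **Reduction of the registered stub `stub_coarseCapture` to mass capture (kernel-checked).** If, for the tolerance `ε > 0`,
in every short cell one admissible seed makes every class solution, uniformly in small `ν`, eventually-and-forever MASS-captured at
radius `ℓ/4` — a centre `(a, b)` with `|b| ≤ ℓ/4`, outside-`|ω|`-mass and positive-vorticity mass of the cell both `≤ εℓ/2`, and
`∂ₓv(t)` integrable on the period strip (hypothesis `hM`, "MassCapture `ε`", inlined; OPEN: the dynamical content of the outer half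
of the line) — then the registered statement of `stub_coarseCapture` holds at `ε` verbatim: the missing circulation clause
`|boxCirc + ℓ| ≤ εℓ` is supplied by `captureBookkeeping` (`≤ εℓ/2`), and the two mass clauses are weakened from `εℓ/2` to `εℓ`.
[folklore] -/
theorem coarseCapture_of_massCapture (ε : ℝ) (hε : 0 < ε)
    (hM : ∃ L₀ : ℝ, 0 < L₀ ∧ L₀ ≤ 1 ∧ ∀ ℓ : ℝ, 0 < ℓ → ℓ ≤ L₀ →
      ∃ θ₁ θ₂ : ℝ → ℝ → ℝ, IsAdmissiblePerturbation ℓ θ₁ θ₂ ∧ ∃ ν₀ : ℝ, 0 < ν₀ ∧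
        ∀ ν : ℝ, 0 < ν → ν ≤ ν₀ → ∀ u v p : ℝ → ℝ → ℝ → ℝ, InClass ν ℓ θ₁ θ₂ u v p →
          ∃ T₁ : ℝ, 0 < T₁ ∧ ∀ t : ℝ, T₁ ≤ t → ∃ a b : ℝ, |b| ≤ ℓ / 4 ∧
            cellAbsVortOutside ℓ (u t) (v t) a b (ℓ / 4) ≤ ENNReal.ofReal (ε / 2 * ℓ) ∧
            cellPosVort ℓ (u t) (v t) a ≤ ENNReal.ofReal (ε / 2 * ℓ) ∧
            Integrable (fun q : ℝ × ℝ => dX (v t) q.1 q.2) ((volume.restrict (Ioc (a - ℓ / 2) (a + ℓ / 2))).prod volume)) :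
    ∃ L₀ : ℝ, 0 < L₀ ∧ L₀ ≤ 1 ∧ ∀ ℓ : ℝ, 0 < ℓ → ℓ ≤ L₀ →
      ∃ θ₁ θ₂ : ℝ → ℝ → ℝ, IsAdmissiblePerturbation ℓ θ₁ θ₂ ∧ ∃ ν₀ : ℝ, 0 < ν₀ ∧
        ∀ ν : ℝ, 0 < ν → ν ≤ ν₀ → ∀ u v p : ℝ → ℝ → ℝ → ℝ, InClass ν ℓ θ₁ θ₂ u v p →
          ∃ T₁ : ℝ, ∀ t : ℝ, T₁ ≤ t → IsCaptured ℓ ε (ℓ / 4) (u t) (v t) := by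
  obtain ⟨L₀, hL₀, hL₀1, hM'⟩ := hM
  refine ⟨L₀, hL₀, hL₀1, fun ℓ hℓ hℓL₀ => ?_⟩
  obtain ⟨θ₁, θ₂, hadm, ν₀, hν₀, hM''⟩ := hM' ℓ hℓ hℓL₀
  refine ⟨θ₁, θ₂, hadm, ν₀, hν₀, fun ν hν hνle u v p hIn => ?_⟩
  obtain ⟨T₁, hT₁, hlate⟩ := hM'' ν hν hνle u v p hIn
  refine ⟨T₁, fun t ht => ?_⟩
  obtain ⟨a, b, hb, hout, hpos, hint⟩ := hlate t ht
  have htpos : 0 < t := hT₁.trans_le ht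
  have hr : (0 : ℝ) < ℓ / 4 := by positivity
  have hrℓ : ℓ / 4 < ℓ / 2 := by linarith
  have hεℓ : ε / 2 * ℓ ≤ ε * ℓ := by nlinarith
  have hfin : cellAbsVortOutside ℓ (u t) (v t) a b (ℓ / 4) ≠ ⊤ :=
    ne_top_of_le_ne_top ENNReal.ofReal_ne_top hout
  have hcirc := captureBookkeeping hIn hℓ htpos hr hrℓ hint hfin
  have h1 : (cellAbsVortOutside ℓ (u t) (v t) a b (ℓ / 4)).toReal ≤ ε / 2 * ℓ :=
    ENNReal.toReal_le_of_le_ofReal (by positivity) hout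
  exact ⟨a, b, hb, by linarith, hout.trans (ENNReal.ofReal_le_ofReal hεℓ),
    hpos.trans (ENNReal.ofReal_le_ofReal hεℓ)⟩

end Summit.AnomalousDissipation.AnomalousDissipation.Theorems.StrainedLayerLaw.ContractionCapture

end
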